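import Summits.HubbardSuperconductivity.HubbardSuperconductivity.Theorems.WidthHaldaneTubeKinematics
import Literature.MathematicalPhysics.QuantumLattice.FermionOperatorsProofs
import Literature.MathematicalPhysics.QuantumLattice.FermionOperatorsEtaSu2Proofs
import Literature.MathematicalPhysics.QuantumLattice.FermionOperatorsEtaSpinProofs
import Literature.MathematicalPhysics.QuantumLattice.FinDimSpectrumSectorGibbsLimit
import Literature.MathematicalPhysics.QuantumLattice.SectorSpectrum
import Literature.MathematicalPhysics.QuantumLattice.HubbardModelParticleHoleProofs
import Literature.MathematicalPhysics.QuantumLattice.HubbardWave0RepulsiveProofs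

/-!
# Yang's `η`-pairing on the even Hubbard tubes: the pair-addition energy is at most `U`

Support file for the cruxes stated over `WidthHaldaneDefs` (routes `WidthHaldane`, `SeamInduction`;
items stmt-HubbardSuperconductivity-16312 `WidthUniformThermodynamics`, 18510
`PerWidthThermodynamics`, 18509 `SeamGluingLocality`, 16311 `WidthHaldaneBridge`), whose second
conjunct is a two-sided bound `0 < ẽ″_{L,M} ≤ k₀` on the inverse pair compressibility
`ẽ″_{L,M} = LM[E(N+2) + E(N-2) - 2E(N)]/4`, a second difference of `(N, S^z = 0)` sector energies
of the pure Hubbard tube `ℤ/L × ℤ/M` (`L`, `M` even) at the filling `N = N_{L,M}(δ)`.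

The ONLY rigorous handle on these differences known in print is Yang's `η`-pairing `SU(2)`: on a
bipartite lattice `[H, η†] = U η†` (Yang 1989), so `η†` maps an `(N, S^z)` sector ground state `ψ`
to an EXACT eigenvector `η†ψ` of the `(N+2, S^z)` sector with energy `E + U`, and `η†ψ ≠ 0` below
half filling (`‖η†ψ‖² = ‖ηψ‖² + (|Λ| - N)‖ψ‖²`, Yang–Zhang 1990). Everything is PROVED here from the
tree's `η`-algebra (`hamiltonian_commutator_etaRaise`, `etaRaise_commutator_etaLower`,
`totalNumber_commutator_etaRaise_holds`, `etaRaise_commute_spin_holds`) and sector spectral theory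
(`sector_groundState`, `minEnergyOn_le_rayleigh_of_mem`); no definition, no named fact:

* `minEnergyOn_szSector_add_two_le` — GENERIC: for any Hermitian `H` on `Fock (Orb Λ)` with
  `[H, η†_ε] = U η†_ε` and any sector ground state at `N < |Λ|`:
  `E_H(N+2, S^z) ≤ E_H(N, S^z) + U`;
* `exists_bipartite_sign` — the tube `ℤ/L × ℤ/M` with `L`, `M` even is bipartite
  (`ε = (-1)^{a+b}` is consistent around both cycles exactly because `L`, `M` are even);
* `tubeTwist_commutator_etaRaise` — the seam twist satisfies
  `[Tw(θ), η†] = (e^{-iθ} - e^{iθ}) Σ_b ε K_b`, so the twisted tube keeps the `η`-symmetry iff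
  `e^{iθ} = e^{-iθ}` (`θ ∈ πℤ`: periodic and antiperiodic closings), `tubeH_commutator_etaRaise`;
* `exists_isGroundStateInSector_tubeH` — sector ground states of the TWISTED tube exist;
* `tubeEnergy_add_two_le` — **MAIN: `E_{L,M}(U; θ, 2n+2) ≤ E_{L,M}(U; θ, 2n) + U`** for `L`, `M`
  even, `2n < LM`, every `U`, every labelling, `e^{iθ} = e^{-iθ}`; at `θ = 0`:
  `tubeEnergy_zero_add_two_le`; at `θ = π`: `tubeEnergy_pi_add_two_le`;
* companion file `WidthHaldaneTubePairSteps`: at the cruxes' filling `N = N_{L,M}(δ)` both pair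
  steps are `≤ U`, `ẽ″_{L,M} ≤ (LM/4)(U - [E(N) - E(N-2)])`, and what this says under the cruxes'
  hypothesis `UniformThermo`.

References: C. N. Yang, PRL 63 (1989) 2144, eqs. (4)–(6); C. N. Yang, S. C. Zhang, Mod. Phys. Lett.
B 4 (1990) 759, Theorem 1; F. H. L. Essler et al., *The One-Dimensional Hubbard Model* (2005) §2.2.5;
E. H. Lieb, PRL 62 (1989) 1201 (sectors `(N, S^z)`); H. Tasaki, *Physics and Mathematics of Quantum
Many-Body Systems* (2020) §2.2 (variational principle in an invariant sector).
-/

noncomputable section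

namespace Summit.HubbardSuperconductivity.HubbardSuperconductivity.Theorems.WidthHaldane

set_option linter.dupNamespace false -- summit = problem name (single-conjunct summit), D-0017

open scoped BigOperators Classical Matrix ComplexConjugate ComplexOrder
open Matrix Literature.MathematicalPhysics.QuantumLattice

/-! ### Generic: `η†` on the joint sectors, its norm, and the pair-addition bound -/

section Generic

variable {Λ : Type*} [LinearOrder Λ] [Fintype Λ]

/-- **`η†` maps the sector `(N, S^z)` into `(N+2, S^z)`**: `[N̂, η†] = 2η†`
(`totalNumber_commutator_etaRaise_holds`) and `[S^z, η†] = 0` (`etaRaise_commute_spin_holds`).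
Yang–Zhang, Mod. Phys. Lett. B 4 (1990) 759, Theorem 1. [cite: YangZhang1990, Theorem 1] -/
theorem etaRaise_mulVec_mem_szSector (ε : Λ → ℤˣ) {N : ℕ} {Sz : ℝ} {ψ : Fock (Orb Λ)}
    (hψ : ψ ∈ szSector N Sz) : etaRaise ε *ᵥ ψ ∈ szSector (N + 2) Sz := by
  rw [mem_szSector_iff] at hψ ⊢
  obtain ⟨hN, hS⟩ := hψ
  refine ⟨?_, ?_⟩
  · rw [LiebTwo.isNParticle_iff_totalNumber] at hN ⊢
    have h' : totalNumber * etaRaise ε = (2 : ℂ) • etaRaise ε + etaRaise ε * totalNumber :=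
      eq_add_of_sub_eq (totalNumber_commutator_etaRaise_holds (Λ := Λ) ε)
    rw [mulVec_mulVec, h', add_mulVec, smul_mulVec, ← mulVec_mulVec, hN, mulVec_smul,
      ← add_smul]
    congr 1
    push_cast
    ring
  · have hc : etaRaise ε * HubbardWave0.spinZ = HubbardWave0.spinZ * etaRaise ε :=
      (etaRaise_commute_spin_holds (Λ := Λ) ε).2
    rw [mulVec_mulVec, ← hc, ← mulVec_mulVec, hS, mulVec_smul]

omit [LinearOrder Λ] [Fintype Λ] in
/-- `‖Aψ‖² = ⟨ψ, A†A ψ⟩`. [folklore] -/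
theorem star_mulVec_dotProduct_mulVec {ι : Type*} [Fintype ι] (A : Matrix ι ι ℂ)
    (ψ : ι → ℂ) : star (A *ᵥ ψ) ⬝ᵥ (A *ᵥ ψ) = star ψ ⬝ᵥ ((Aᴴ * A) *ᵥ ψ) := by
  rw [star_mulVec, ← dotProduct_mulVec, mulVec_mulVec]

/-- **Yang–Zhang norm identity**: `‖η†ψ‖² = ‖ηψ‖² + (|Λ| - N)‖ψ‖²` on `N`-particle vectors
(`ηη† = η†η - 2η^z`, `2η^z = N̂ - |Λ|`). Yang–Zhang, Mod. Phys. Lett. B 4 (1990) 759, Theorem 1,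
eq. (5). [cite: YangZhang1990, Theorem 1] -/
theorem star_etaRaise_mulVec_dotProduct (ε : Λ → ℤˣ) {N : ℕ} {ψ : Fock (Orb Λ)}
    (hN : IsNParticle N ψ) :
    star (etaRaise ε *ᵥ ψ) ⬝ᵥ (etaRaise ε *ᵥ ψ) =
      star (etaLower ε *ᵥ ψ) ⬝ᵥ (etaLower ε *ᵥ ψ) +
        ((Fintype.card Λ : ℂ) - N) * (star ψ ⬝ᵥ ψ) := by
  have h1 : etaLower ε * etaRaise ε = etaRaise ε * etaLower ε - (2 : ℂ) • etaZ := by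
    rw [← etaRaise_commutator_etaLower ε]
    abel
  have h2 : (etaRaise ε)ᴴ = etaLower ε := rfl
  have h3 : (etaLower ε)ᴴ = etaRaise ε := conjTranspose_conjTranspose _
  rw [star_mulVec_dotProduct_mulVec, star_mulVec_dotProduct_mulVec, h2, h3, h1, two_smul_etaZ,
    sub_mulVec, sub_mulVec, smul_mulVec, one_mulVec, totalNumber_mulVec_of_isNParticle hN,
    dotProduct_sub, dotProduct_sub, dotProduct_smul, dotProduct_smul]
  simp only [smul_eq_mul]
  ring

/-- **`η†ψ ≠ 0` strictly below half filling**: for a nonzero `N`-particle `ψ` with `N < |Λ|`,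
`‖η†ψ‖² ≥ (|Λ| - N)‖ψ‖² > 0`. Yang–Zhang, Mod. Phys. Lett. B 4 (1990) 759, Theorem 1 (the
multiplet through a weight-`m < 0` vector extends upward). [cite: YangZhang1990, Theorem 1] -/
theorem etaRaise_mulVec_ne_zero (ε : Λ → ℤˣ) {N : ℕ} {ψ : Fock (Orb Λ)} (hN : IsNParticle N ψ)
    (hψ : ψ ≠ 0) (hlt : N < Fintype.card Λ) : etaRaise ε *ᵥ ψ ≠ 0 := by
  intro h0
  have hnorm := star_etaRaise_mulVec_dotProduct ε hN
  rw [h0, star_zero, zero_dotProduct] at hnorm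
  have ha : (0 : ℂ) ≤ star (etaLower ε *ᵥ ψ) ⬝ᵥ (etaLower ε *ᵥ ψ) := dotProduct_star_self_nonneg _
  have hb : (0 : ℂ) < star ψ ⬝ᵥ ψ := dotProduct_star_self_pos_iff.2 hψ
  have hc : (0 : ℂ) < (Fintype.card Λ : ℂ) - N := by
    have : ((Fintype.card Λ : ℂ) - N) = ((Fintype.card Λ - N : ℕ) : ℂ) := by
      push_cast [Nat.cast_sub hlt.le]
      ring
    rw [this]
    exact_mod_cast Nat.sub_pos_of_lt hlt
  have := add_pos_of_nonneg_of_pos ha (mul_pos hc hb)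
  rw [← hnorm] at this
  exact lt_irrefl _ this

/-- **The pair-addition energy is at most `U` (generic form).** Let `H` be Hermitian on
`Fock (Orb Λ)` with Yang's commutator `[H, η†_ε] = U η†_ε` for some sign `ε`, and let `ψ` be a ground
state of `H` in the sector `(N, S^z)` with `N < |Λ|`. Then `η†ψ` is a nonzero `(E + U)`-eigenvector in
the sector `(N+2, S^z)`, so by the variational principle
`E_H(N+2, S^z) ≤ E_H(N, S^z) + U`. Yang, PRL 63 (1989) 2144, eq. (6) and the remark after it;
Tasaki (2020) §2.2. [cite: Yang1989, eq. (6)] -/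
theorem minEnergyOn_szSector_add_two_le {H : Matrix (Finset (Orb Λ)) (Finset (Orb Λ)) ℂ}
    (hH : H.IsHermitian) (ε : Λ → ℤˣ) {U : ℝ}
    (hc : H * etaRaise ε - etaRaise ε * H = (U : ℂ) • etaRaise ε) {N : ℕ} {Sz : ℝ}
    {ψ : Fock (Orb Λ)} (hgs : IsGroundStateInSector H N Sz ψ) (hlt : N < Fintype.card Λ) :
    H.minEnergyOn (szSector (N + 2) Sz) ≤ H.minEnergyOn (szSector N Sz) + U := by
  obtain ⟨hmem, hne, hHψ⟩ := hgs
  have hNpart : IsNParticle N ψ := ((mem_szSector_iff N Sz ψ).1 hmem).1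
  have hφne : etaRaise ε *ᵥ ψ ≠ 0 := etaRaise_mulVec_ne_zero ε hNpart hne hlt
  have hφmem : etaRaise ε *ᵥ ψ ∈ szSector (N + 2) Sz := etaRaise_mulVec_mem_szSector ε hmem
  -- `H (η† ψ) = (E + U) η† ψ`
  set E := H.minEnergyOn (szSector N Sz) with hE
  have hHφ : H *ᵥ (etaRaise ε *ᵥ ψ) = (((E + U : ℝ)) : ℂ) • (etaRaise ε *ᵥ ψ) := by
    have h' : H * etaRaise ε = (U : ℂ) • etaRaise ε + etaRaise ε * H := eq_add_of_sub_eq hc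
    rw [mulVec_mulVec, h', add_mulVec, smul_mulVec, ← mulVec_mulVec, hHψ, mulVec_smul,
      ← add_smul, add_comm]
    push_cast
    rfl
  obtain ⟨c, -, hc1⟩ := exists_smul_unit hφne
  have hle := minEnergyOn_le_rayleigh_of_mem hH (szSector (N + 2) Sz)
    (Submodule.smul_mem _ c hφmem) hc1
  rw [mulVec_smul, hHφ, smul_comm, dotProduct_smul, hc1, smul_eq_mul, mul_one,
    Complex.ofReal_re] at hle
  exact hle

/-- **Commutator of one bond's twisted hopping with `η†`.** For sites `x`, `y` of opposite sign
(`ε_x = -ε_y`) and any amplitudes `α`, `β`: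
`[Σ_σ (α c†_{xσ}c_{yσ} + β c†_{yσ}c_{xσ}), η†] = (α - β) ε_y (c†_{x↑}c†_{y↓} - c†_{x↓}c†_{y↑})` — a
Hermitian bond (`β = ᾱ` real, i.e. `α = β`) commutes with `η†`, a complex Peierls phase does not.
From `hopTerm_commutator_etaRaise`; Yang, PRL 63 (1989) 2144, eq. (6); Essler et al. (2005) §2.2.5,
eq. (2.84). [cite: Yang1989, eq. (6)] -/
theorem seamPair_commutator_etaRaise (ε : Λ → ℤˣ) {x y : Λ} (hxy : ε x = -ε y) (α β : ℂ) :
    (∑ σ : Fin 2, (α • (creation (orb x σ) * annihilation (orb y σ)) +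
        β • (creation (orb y σ) * annihilation (orb x σ)))) * etaRaise ε -
      etaRaise ε * (∑ σ : Fin 2, (α • (creation (orb x σ) * annihilation (orb y σ)) +
        β • (creation (orb y σ) * annihilation (orb x σ)))) =
      ((α - β) * ((ε y : ℤ) : ℂ)) •
        (creation (orb x 0) * creation (orb y 1) - creation (orb x 1) * creation (orb y 0)) := by
  have hterm : ∀ σ : Fin 2,
      (α • (creation (orb x σ) * annihilation (orb y σ)) +
          β • (creation (orb y σ) * annihilation (orb x σ))) * etaRaise ε -
        etaRaise ε * (α • (creation (orb x σ) * annihilation (orb y σ)) +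
          β • (creation (orb y σ) * annihilation (orb x σ))) =
      α • (creation (orb x σ) * annihilation (orb y σ) * etaRaise ε -
          etaRaise ε * (creation (orb x σ) * annihilation (orb y σ))) +
        β • (creation (orb y σ) * annihilation (orb x σ) * etaRaise ε -
          etaRaise ε * (creation (orb y σ) * annihilation (orb x σ))) := by
    intro σ
    simp only [add_mul, mul_add, smul_mul_assoc, mul_smul_comm, smul_sub]
    abel
  have hx : ((ε x : ℤ) : ℂ) = -((ε y : ℤ) : ℂ) := by rw [hxy, Units.val_neg, Int.cast_neg]
  have h10 : (1 : Fin 2) ≠ 0 := by decide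
  rw [Finset.sum_mul, Finset.mul_sum, ← Finset.sum_sub_distrib]
  simp only [hterm, hopTerm_commutator_etaRaise, Fin.sum_univ_two, Fin.isValue, if_true,
    if_neg h10, hx, creation_mul_creation_eq_neg (orb y 0) (orb x 1),
    creation_mul_creation_eq_neg (orb y 1) (orb x 0)]
  module

end Generic

/-! ### The even tube is bipartite; the seam twist and `η†` -/

section Tube

variable (L M : ℕ) [NeZero L] [NeZero M] (Λ : Type) [LinearOrder Λ] [Fintype Λ]
  (e : Λ ≃ ZMod L × ZMod M)

/-- On `ℤ/L` with `L` even the parity of the representative `val` flips under `a ↦ a + 1`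
(including across the wrap `L - 1 ↦ 0`). [folklore] -/
theorem val_add_one_mod_two {L : ℕ} [NeZero L] (hL : Even L) (a : ZMod L) :
    (a + 1).val % 2 = (a.val + 1) % 2 := by
  have h2 : 2 ≤ L := by
    obtain ⟨k, hk⟩ := hL
    have := NeZero.ne L
    omega
  haveI : Fact (1 < L) := ⟨by omega⟩
  rw [ZMod.val_add, ZMod.val_one, Nat.mod_mod_of_dvd _ (even_iff_two_dvd.1 hL)]

omit [LinearOrder Λ] [Fintype Λ] in
/-- **The even tube is bipartite**: for `L`, `M` even there is a sign `ε : Λ → ℤˣ`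
(`ε = (-1)^{a+b}` at `e⁻¹(a, b)`, representatives in `[0,L) × [0,M)`) with `ε_x = -ε_y` on every
bond of `tubeGraph e` — consistent around both cycles precisely because both circumferences are
even (Essler et al. (2005) §2.2.5: the `η`-symmetry "holds only for an even number of lattice
sites" in each periodic direction). [cite: EsslerEtAl2005, §2.2.5] -/
theorem exists_bipartite_sign (hL : Even L) (hM : Even M) :
    ∃ ε : Λ → ℤˣ, ∀ x y, (tubeGraph e).Adj x y → ε x = -ε y := by
  refine ⟨fun x => if ((e x).1.val + (e x).2.val) % 2 = 0 then 1 else -1, ?_⟩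
  intro x y hxy
  have key : ((e y).1.val + (e y).2.val) % 2 = ((e x).1.val + (e x).2.val + 1) % 2 := by
    obtain ⟨⟨a, b⟩, rfl⟩ := e.symm.surjective x
    obtain ⟨⟨a', b'⟩, rfl⟩ := e.symm.surjective y
    simp only [Equiv.apply_symm_apply, EmbeddingLike.apply_eq_iff_eq, SimpleGraph.fromRel_adj,
      tubeGraph, ne_eq, Prod.mk.injEq] at hxy ⊢
    have hLa := val_add_one_mod_two hL a
    have hLa' := val_add_one_mod_two hL a'
    have hMb := val_add_one_mod_two hM b
    have hMb' := val_add_one_mod_two hM b'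
    rcases hxy.2 with (⟨h1, h2⟩ | ⟨h1, h2⟩) | (⟨h1, h2⟩ | ⟨h1, h2⟩)
    · subst h1; subst h2; omega
    · subst h1; subst h2; omega
    · subst h1; subst h2; omega
    · subst h1; subst h2; omega
  dsimp only
  by_cases hx : ((e x).1.val + (e x).2.val) % 2 = 0
  · have hy : ¬ ((e y).1.val + (e y).2.val) % 2 = 0 := by omega
    rw [if_pos hx, if_neg hy, neg_neg]
  · have hy : ((e y).1.val + (e y).2.val) % 2 = 0 := by omega
    rw [if_neg hx, if_pos hy]

omit [NeZero L] [NeZero M] [LinearOrder Λ] [Fintype Λ] in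
/-- The two ends `e⁻¹(0, b)`, `e⁻¹(-1, b)` of a seam bond are adjacent in the tube graph
(`L ≥ 2`, so that they are distinct). [folklore] -/
theorem tubeGraph_adj_seam (hL : 2 ≤ L) (b : ZMod M) :
    (tubeGraph e).Adj (e.symm (0, b)) (e.symm (-1, b)) := by
  haveI : Fact (1 < L) := ⟨by omega⟩
  rw [SimpleGraph.fromRel_adj]
  refine ⟨fun h => ?_, Or.inr (Or.inl ?_)⟩
  · have h1 : ((0 : ZMod L), b) = ((-1 : ZMod L), b) := e.symm.injective h
    have h2 : (1 : ZMod L) = 0 := neg_eq_zero.1 ((Prod.mk.injEq _ _ _ _).mp h1).1.symm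
    exact one_ne_zero h2
  · simp only [Equiv.apply_symm_apply, neg_add_cancel]

omit [NeZero L] [NeZero M] in
/-- **Yang's commutator for the pure tube**: `[tubeH0, η†_ε] = U η†_ε` for every bipartite sign `ε`
of the tube graph (`hamiltonian_commutator_etaRaise`). Yang, PRL 63 (1989) 2144, eq. (6).
[cite: Yang1989, eq. (6)] -/
theorem tubeH0_commutator_etaRaise (ε : Λ → ℤˣ) (hε : ∀ x y, (tubeGraph e).Adj x y → ε x = -ε y)
    (U : ℝ) :
    tubeH0 L M Λ e U * etaRaise ε - etaRaise ε * tubeH0 L M Λ e U = (U : ℂ) • etaRaise ε :=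
  hamiltonian_commutator_etaRaise (tubeGraph e) ε hε 1 U

/-- **The seam twist versus `η†`**: `[Tw(θ), η†_ε] = (e^{-iθ} - e^{iθ}) Σ_b ε_{(-1,b)} K_b` with
`K_b = c†_{(0,b)↑}c†_{(-1,b)↓} - c†_{(0,b)↓}c†_{(-1,b)↑}`, for any sign flipping across the seam
bonds. So a Peierls phase breaks the `η`-symmetry unless `e^{iθ} = e^{-iθ}`, i.e. unless the pair
(charge `2`) sees a trivial phase `e^{2iθ} = 1`. Essler et al. (2005) §2.2.5, eq. (2.84) (bondwise
form). [cite: EsslerEtAl2005, §2.2.5 eq. (2.84)] -/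
theorem tubeTwist_commutator_etaRaise (ε : Λ → ℤˣ)
    (hε : ∀ b : ZMod M, ε (e.symm (0, b)) = -ε (e.symm (-1, b))) (θ : ℝ) :
    tubeTwist L M Λ e θ * etaRaise ε - etaRaise ε * tubeTwist L M Λ e θ =
      (Complex.exp (-(Complex.I * θ)) - Complex.exp (Complex.I * θ)) •
        ∑ b : ZMod M, (((ε (e.symm (-1, b)) : ℤ) : ℂ)) •
          (creation (orb (e.symm (0, b)) 0) * creation (orb (e.symm (-1, b)) 1) -
            creation (orb (e.symm (0, b)) 1) * creation (orb (e.symm (-1, b)) 0)) := by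
  unfold tubeTwist
  rw [Finset.sum_mul, Finset.mul_sum, ← Finset.sum_sub_distrib, Finset.smul_sum]
  refine Finset.sum_congr rfl fun b _ => ?_
  rw [seamPair_commutator_etaRaise ε (hε b), smul_smul]
  congr 1
  ring

/-- **Yang's commutator for the twisted tube at `e^{iθ} = e^{-iθ}`** (`θ ∈ πℤ`: periodic or
antiperiodic closing of the long cycle; `L ≥ 2`): `[tubeH0 + Tw(θ), η†_ε] = U η†_ε` for every
bipartite sign `ε`. Yang, PRL 63 (1989) 2144, eq. (6). [cite: Yang1989, eq. (6)] -/
theorem tubeH_commutator_etaRaise (hL : 2 ≤ L) (ε : Λ → ℤˣ)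
    (hε : ∀ x y, (tubeGraph e).Adj x y → ε x = -ε y) (U θ : ℝ)
    (hθ : Complex.exp (Complex.I * θ) = Complex.exp (-(Complex.I * θ))) :
    (tubeH0 L M Λ e U + tubeTwist L M Λ e θ) * etaRaise ε -
        etaRaise ε * (tubeH0 L M Λ e U + tubeTwist L M Λ e θ) = (U : ℂ) • etaRaise ε := by
  have hseam : ∀ b : ZMod M, ε (e.symm (0, b)) = -ε (e.symm (-1, b)) :=
    fun b => hε _ _ (tubeGraph_adj_seam L M Λ e hL b)
  have h1 := tubeH0_commutator_etaRaise L M Λ e ε hε U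
  have h2 := tubeTwist_commutator_etaRaise L M Λ e ε hseam θ
  rw [hθ, sub_self, zero_smul] at h2
  rw [add_mul, mul_add, add_sub_add_comm, h1, h2, add_zero]

/-- **Sector ground states of the twisted tube exist** in every sector `(2n, S^z = 0)`, `n ≤ LM`:
the twisted tube is Hermitian (`isHermitian_tubeH`) and block diagonal in `(N↑, N↓)`
(`preservesSectors_tubeH`), so `sector_groundState` applies to the coordinate subspace
`szSector (2n) 0`. Tasaki (2020) §2.2; Lieb, PRL 62 (1989) 1201, proof of Theorem 1.
[cite: LiebPRL1989, proof of Theorem 1] -/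
theorem exists_isGroundStateInSector_tubeH (U θ : ℝ) {n : ℕ} (hn : n ≤ L * M) :
    ∃ ψ : Fock (Orb Λ),
      IsGroundStateInSector (tubeH0 L M Λ e U + tubeTwist L M Λ e θ) (2 * n) 0 ψ := by
  have hcard : n ≤ Fintype.card Λ := by rwa [card_carrier L M Λ e]
  obtain ⟨α₀, -, hα₀⟩ : ∃ α₀ : Finset Λ, α₀ ⊆ Finset.univ ∧ α₀.card = n :=
    Finset.exists_subset_card_eq (by rwa [Finset.card_univ])
  have hp : ∃ s : Finset (Orb Λ), (upPart s).card = n ∧ (downPart s).card = n :=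
    ⟨pairSet α₀ α₀, by rw [upPart_pairSet, hα₀], by rw [downPart_pairSet, hα₀]⟩
  have hinv : ∀ s s' : Finset (Orb Λ), ¬((upPart s).card = n ∧ (downPart s).card = n) →
      ((upPart s').card = n ∧ (downPart s').card = n) →
        (tubeH0 L M Λ e U + tubeTwist L M Λ e θ) s s' = 0 := by
    intro s s' hs hs'
    by_contra h
    have := preservesSectors_tubeH L M Λ e U θ s s' h
    exact hs ⟨this.1.trans hs'.1, this.2.trans hs'.2⟩
  obtain ⟨⟨v, hv, hv0, hHv⟩, -⟩ := sector_groundState (tubeH0 L M Λ e U + tubeTwist L M Λ e θ)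
    (isHermitian_tubeH L M Λ e U θ) (fun s => (upPart s).card = n ∧ (downPart s).card = n) hp hinv
    (szSector (2 * n) 0) (fun v => mem_szSector_two_mul_zero_iff n v)
  exact ⟨v, hv, hv0, hHv⟩

/-! ### The pair-addition energy of the even tubes is at most `U` -/

/-- **MAIN — the pair-addition energy is at most `U`**: on the pure Hubbard tube `ℤ/L × ℤ/M` with
`L`, `M` even (bipartite), for every `U`, every labelling, every closing with `e^{iθ} = e^{-iθ}` and
every `2n < LM`:
`E_{L,M}(U; θ, 2n+2) ≤ E_{L,M}(U; θ, 2n) + U`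
(`η†` lifts a `(2n, S^z = 0)` ground state to an exact eigenvector of the `(2n+2, S^z = 0)` sector at
energy `E + U`, nonzero below half filling). Yang, PRL 63 (1989) 2144, eq. (6) ff.; Yang–Zhang (1990)
Theorem 1. [cite: Yang1989, eq. (6)] -/
theorem tubeEnergy_add_two_le (hL : Even L) (hM : Even M) (U θ : ℝ)
    (hθ : Complex.exp (Complex.I * θ) = Complex.exp (-(Complex.I * θ))) {n : ℕ}
    (hn : 2 * n < L * M) :
    tubeEnergy L M Λ e U θ (2 * n + 2) ≤ tubeEnergy L M Λ e U θ (2 * n) + U := by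
  have hL2 : 2 ≤ L := by
    obtain ⟨k, hk⟩ := hL
    have := NeZero.ne L
    omega
  obtain ⟨ε, hε⟩ := exists_bipartite_sign L M Λ e hL hM
  obtain ⟨ψ, hψ⟩ := exists_isGroundStateInSector_tubeH L M Λ e U θ (n := n) (by omega)
  have hlt : 2 * n < Fintype.card Λ := by rwa [card_carrier L M Λ e]
  rw [tubeEnergy_eq, tubeEnergy_eq]
  exact minEnergyOn_szSector_add_two_le (isHermitian_tubeH L M Λ e U θ) ε
    (tubeH_commutator_etaRaise L M Λ e hL2 ε hε U θ hθ) hψ hlt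

/-- **Zero twist**: `E_{L,M}(U; 0, 2n+2) ≤ E_{L,M}(U; 0, 2n) + U` for `L`, `M` even, `2n < LM`.
[cite: Yang1989, eq. (6)] -/
theorem tubeEnergy_zero_add_two_le (hL : Even L) (hM : Even M) (U : ℝ) {n : ℕ}
    (hn : 2 * n < L * M) :
    tubeEnergy L M Λ e U 0 (2 * n + 2) ≤ tubeEnergy L M Λ e U 0 (2 * n) + U :=
  tubeEnergy_add_two_le L M Λ e hL hM U 0 (by simp) hn

/-- **Half-flux-quantum twist** (antiperiodic closing, seam hoppings `+1`): the `η`-symmetry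
survives at `θ = π`, so `E_{L,M}(U; π, 2n+2) ≤ E_{L,M}(U; π, 2n) + U` for `L`, `M` even, `2n < LM`.
[cite: Yang1989, eq. (6)] -/
theorem tubeEnergy_pi_add_two_le (hL : Even L) (hM : Even M) (U : ℝ) {n : ℕ}
    (hn : 2 * n < L * M) :
    tubeEnergy L M Λ e U Real.pi (2 * n + 2) ≤ tubeEnergy L M Λ e U Real.pi (2 * n) + U := by
  refine tubeEnergy_add_two_le L M Λ e hL hM U Real.pi ?_ hn
  rw [Complex.exp_neg, mul_comm, Complex.exp_pi_mul_I]
  norm_num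

end Tube

end Summit.HubbardSuperconductivity.HubbardSuperconductivity.Theorems.WidthHaldane

end
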